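import Mathlib.AlgebraicGeometry.Sites.ElladicCohomology
import Mathlib.RingTheory.RingHom.FaithfullyFlat
import Mathlib.RingTheory.Etale.Weakly
import Literature.AlgebraicGeometry.Motives.EtaleToProetCovers
import HarnessLib

/-!
# Affine objects of `X_proét` and weakly étale / faithfully flat algebras

The dictionary between maps of affine objects of Mathlib's small pro-étale site `X.ProEt` and ring
maps (Bhatt–Scholze, *The pro-étale topology for schemes*, Def. 4.1.1 and §2.3: "`A → B` is weakly
étale if `A → B` and `B ⊗_A B → B` are flat"), used for the limits of the towers of Example 3.1.7 /
Lemma 4.1.8 (exactness of countable products in `Shv(X_proét)`):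

* `weaklyEtale_specMap_iff` — `Spec B → Spec A` is weakly étale iff `A → B` is
  (Mathlib `diagonal_SpecMap`, `Flat.SpecMap_iff`);
* `weaklyEtale_appTop`, `faithfullyFlat_appTop` — a (surjective) map `V → U` of affine objects of
  `X_proét` makes `Γ(V)` a weakly étale (faithfully flat) `Γ(U)`-algebra;
* `proetSpec U B`, `proetSpecHom`, `generate_singleton_proetSpecHom_mem`, `proetSpecLift` —
  conversely `Spec B → U` for a weakly étale `Γ(U)`-algebra `B` is an object of `X_proét` over
  `U`, a pro-étale cover when `B` is faithfully flat, and it factors through any affine `V → U`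
  along a `Γ(U)`-algebra map `Γ(V) → B`.

## References

* B. Bhatt, P. Scholze, *The pro-étale topology for schemes*, Astérisque 369 (2015)
  (arXiv:1309.1198): Def. 4.1.1, Lemma 4.1.6, Lemma 4.1.7, Lemma 4.1.8, Example 3.1.7.
  [BhattScholze2015]

## Design notes

* Mathlib has `Algebra.WeaklyEtale` and the scheme-level `WeaklyEtale` but no
  `HasRingHomProperty` linking them yet; only the `Spec` case is needed and proved here.
* Mathlib searches: `diagonal_SpecMap`, `Flat.SpecMap_iff`, `flat_and_surjective_SpecMap_iff`,
  `Flat.flat_and_surjective_iff_faithfullyFlat_of_isAffine`, `arrowIsoSpecΓOfIsAffine`,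
  `Scheme.isoSpec_inv_naturality`; Literature `weaklyEtale_left`, `ofArrows_mem_proEtTopology`
  (reused). Nothing restated.
-/

universe u

open CategoryTheory CategoryTheory.Limits Opposite AlgebraicGeometry

noncomputable section

-- `X.ProEt = MorphismProperty.Over @WeaklyEtale ⊤ X` feeds the class `@WeaklyEtale` where a
-- `MorphismProperty` is expected; as in Mathlib's `AlgebraicGeometry/Sites/Proetale.lean`, the
-- unifier must be allowed to unfold it when rewriting in goals mentioning objects of `X.ProEt`.
set_option backward.isDefEq.respectTransparency false

namespace Literature.AlgebraicGeometry.Motives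

variable {X : Scheme.{u}}

/-! ### Affine objects of `X_proét` and weakly étale algebras -/

section Algebra

/-- Weak étaleness only depends on `algebraMap` (transport to the `toAlgebra` structure).
[folklore] -/
theorem weaklyEtale_toAlgebra_algebraMap {R S : Type*} [CommRing R] [CommRing S]
    [i : Algebra R S] [Algebra.WeaklyEtale R S] :
    @Algebra.WeaklyEtale R S _ _ (algebraMap R S).toAlgebra := by
  have h : (algebraMap R S).toAlgebra = i := Algebra.algebra_ext _ _ fun _ => rfl
  rw [h]
  infer_instance

/-- **`Spec` of a ring map is weakly étale iff the ring map is weakly étale** (`A → B` flat and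
`B ⊗_A B → B` flat; Bhatt–Scholze Def. 4.1.1 and §2.3, Mathlib `Algebra.WeaklyEtale`): the
diagonal of `Spec B → Spec A` is `Spec` of the multiplication (Mathlib `diagonal_SpecMap`).
[cite: BhattScholze2015, Def. 4.1.1] -/
theorem weaklyEtale_specMap_iff {R S : CommRingCat.{u}} (φ : R ⟶ S) :
    WeaklyEtale (Spec.map φ) ↔ (letI := φ.hom.toAlgebra; Algebra.WeaklyEtale R S) := by
  letI := φ.hom.toAlgebra
  have h₁ : Flat (Spec.map φ) ↔ Module.Flat R S := by
    rw [Flat.SpecMap_iff]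
    exact RingHom.flat_algebraMap_iff
  have h₂ : Flat (pullback.diagonal (Spec.map φ)) ↔
      (Algebra.TensorProduct.lmul' R (S := S)).toRingHom.Flat := by
    change Flat (pullback.diagonal (Spec.map (CommRingCat.ofHom (algebraMap R S)))) ↔ _
    rw [diagonal_SpecMap R S, MorphismProperty.cancel_right_of_respectsIso @Flat,
      Flat.SpecMap_iff, CommRingCat.hom_ofHom]
  rw [weaklyEtale_iff, Algebra.weaklyEtale_iff, h₁, h₂]

variable {U V : X.ProEt} [IsAffine U.left] [IsAffine V.left] (g : V ⟶ U)

/-- **A map `V → U` of affine objects of `X_proét` makes `Γ(V)` a weakly étale `Γ(U)`-algebra**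
(any map in `X_proét` is weakly étale, Bhatt–Scholze Lemma 4.1.7, and `V → U` is `Spec` of
`Γ(U) → Γ(V)`). [cite: BhattScholze2015, Lemma 4.1.7] -/
theorem weaklyEtale_appTop :
    letI := g.left.appTop.hom.toAlgebra
    Algebra.WeaklyEtale Γ(U.left, ⊤) Γ(V.left, ⊤) := by
  have h : WeaklyEtale (Spec.map g.left.appTop) :=
    (MorphismProperty.arrow_mk_iso_iff @WeaklyEtale (arrowIsoSpecΓOfIsAffine g.left)).1
      (weaklyEtale_left g)
  exact (weaklyEtale_specMap_iff _).1 h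

/-- **A surjective map `V → U` of affine objects of `X_proét` makes `Γ(V)` a faithfully flat
`Γ(U)`-algebra** (flat and surjective on spectra; Mathlib
`Flat.flat_and_surjective_iff_faithfullyFlat_of_isAffine`). [folklore] -/
theorem faithfullyFlat_appTop [Surjective g.left] :
    letI := g.left.appTop.hom.toAlgebra
    Module.FaithfullyFlat Γ(U.left, ⊤) Γ(V.left, ⊤) := by
  haveI : WeaklyEtale g.left := weaklyEtale_left g
  exact (Flat.flat_and_surjective_iff_faithfullyFlat_of_isAffine g.left).1
    ⟨inferInstance, inferInstance⟩

end Algebra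

/-! ### `Spec` of a weakly étale `Γ(U)`-algebra as an object of `X_proét` over `U` -/

section Spec

variable (U : X.ProEt) [IsAffine U.left] (B : Type u) [CommRing B] [Algebra Γ(U.left, ⊤) B]

/-- The map `Spec B → Spec Γ(U) ≅ U` for a `Γ(U)`-algebra `B`. [folklore] -/
def specToLeft : Spec (CommRingCat.of B) ⟶ U.left :=
  Spec.map (CommRingCat.ofHom (algebraMap Γ(U.left, ⊤) B)) ≫ U.left.isoSpec.inv

variable [Algebra.WeaklyEtale Γ(U.left, ⊤) B]

/-- `Spec B → U` is weakly étale for `B` weakly étale over `Γ(U)`. [folklore] -/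
instance weaklyEtale_specToLeft : WeaklyEtale (specToLeft U B) := by
  haveI : WeaklyEtale (Spec.map (CommRingCat.ofHom (algebraMap Γ(U.left, ⊤) B))) :=
    (weaklyEtale_specMap_iff _).2 (by
      rw [CommRingCat.hom_ofHom]
      exact weaklyEtale_toAlgebra_algebraMap)
  unfold specToLeft
  infer_instance

/-- **`Spec B` for a weakly étale `Γ(U)`-algebra `B`, as an object of `X_proét`** (over the affine
`U ∈ X_proét`; `Spec B → U → X` is weakly étale, Bhatt–Scholze Lemma 4.1.6). The limits of the
towers of Example 3.1.7 are of this form (Lemma 4.1.8). [cite: BhattScholze2015, Lemma 4.1.8] -/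
def proetSpec : X.ProEt :=
  MorphismProperty.Over.mk ⊤ (specToLeft U B ≫ U.hom)
    (MorphismProperty.comp_mem _ _ _ (weaklyEtale_specToLeft U B) U.prop)

omit [Algebra.WeaklyEtale (Γ(U.left, ⊤)) B] in
/-- Its underlying scheme is `Spec B` (by `rfl`). [folklore] -/
@[simp] theorem proetSpec_left [Algebra.WeaklyEtale Γ(U.left, ⊤) B] :
    (proetSpec U B).left = Spec (CommRingCat.of B) := rfl

omit [Algebra.WeaklyEtale (Γ(U.left, ⊤)) B] in
/-- Its structure map is `Spec B → U → X` (by `rfl`). [folklore] -/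
@[simp] theorem proetSpec_hom [Algebra.WeaklyEtale Γ(U.left, ⊤) B] :
    (proetSpec U B).hom = specToLeft U B ≫ U.hom := rfl

/-- Its underlying scheme `Spec B` is affine. [folklore] -/
instance isAffine_proetSpec_left : IsAffine (proetSpec U B).left :=
  inferInstanceAs (IsAffine (Spec (CommRingCat.of B)))

/-- The structure map `Spec B ⟶ U` in `X_proét`. [folklore] -/
def proetSpecHom : proetSpec U B ⟶ U :=
  MorphismProperty.Over.homMk (specToLeft U B) rfl

/-- The underlying morphism of `Spec B ⟶ U` is `Spec B → Spec Γ(U) ≅ U` (by `rfl`). [folklore] -/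
@[simp] theorem proetSpecHom_left : (proetSpecHom U B).left = specToLeft U B := rfl

/-- For `B` faithfully flat over `Γ(U)`, `Spec B → U` is surjective. [folklore] -/
instance surjective_proetSpecHom_left [Module.FaithfullyFlat Γ(U.left, ⊤) B] :
    Surjective (proetSpecHom U B).left := by
  haveI : Surjective (Spec.map (CommRingCat.ofHom (algebraMap Γ(U.left, ⊤) B))) := by
    refine ((flat_and_surjective_SpecMap_iff _).2 ?_).2
    rw [CommRingCat.hom_ofHom, RingHom.faithfullyFlat_algebraMap_iff]
    infer_instance
  change Surjective (Spec.map (CommRingCat.ofHom (algebraMap Γ(U.left, ⊤) B)) ≫ U.left.isoSpec.inv)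
  infer_instance

/-- **For `B` weakly étale and faithfully flat over `Γ(U)`, `Spec B → U` is a pro-étale cover**
(a surjective map of affines in `X_proét` is an fpqc cover by a weakly étale map, Bhatt–Scholze
Def. 4.1.1 — "as `Spec(B) → Spec(A)` is an fpqc cover", Example 3.1.7).
[cite: BhattScholze2015, Example 3.1.7] -/
theorem generate_singleton_proetSpecHom_mem [Module.FaithfullyFlat Γ(U.left, ⊤) B] :
    Sieve.generate (Presieve.singleton (proetSpecHom U B)) ∈ Scheme.ProEt.topology X U := by
  have h := ofArrows_mem_proEtTopology (fun _ : PUnit.{1} => proetSpec U B)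
    (fun _ => proetSpecHom U B) fun x => ?_
  · rwa [Sieve.ofArrows, Presieve.ofArrows_pUnit] at h
  · obtain ⟨y, hy⟩ := (surjective_proetSpecHom_left U B).surj x
    exact ⟨PUnit.unit, y, hy⟩

variable {U B} in
/-- **Factorisation of `Spec B → U` through an affine `V → U` along a `Γ(U)`-algebra map
`Γ(V) → B`**: the map `Spec B → Spec Γ(V) ≅ V` of `X_proét`. [folklore] -/
def proetSpecLift {V : X.ProEt} [IsAffine V.left] (g : V ⟶ U) (ψ : Γ(V.left, ⊤) →+* B)
    (hψ : ψ.comp g.left.appTop.hom = algebraMap Γ(U.left, ⊤) B) : proetSpec U B ⟶ V :=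
  MorphismProperty.Over.homMk (Spec.map (CommRingCat.ofHom ψ) ≫ V.left.isoSpec.inv) (by
    have hV : V.hom = g.left ≫ U.hom := (MorphismProperty.Over.w g).symm
    rw [proetSpec_hom, hV, Category.assoc, ← Scheme.isoSpec_inv_naturality_assoc,
      ← Spec.map_comp_assoc, specToLeft, Category.assoc]
    congr 3
    ext : 1
    simpa only [CommRingCat.hom_comp, CommRingCat.hom_ofHom] using hψ)

/-- The factorisation property `Spec B → V → U = Spec B → U`. [folklore] -/
@[simp] theorem proetSpecLift_comp {V : X.ProEt} [IsAffine V.left] (g : V ⟶ U)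
    (ψ : Γ(V.left, ⊤) →+* B) (hψ : ψ.comp g.left.appTop.hom = algebraMap Γ(U.left, ⊤) B) :
    proetSpecLift g ψ hψ ≫ g = proetSpecHom U B := by
  refine MorphismProperty.Over.Hom.ext ?_
  change (Spec.map (CommRingCat.ofHom ψ) ≫ V.left.isoSpec.inv) ≫ g.left = specToLeft U B
  rw [Category.assoc, ← Scheme.isoSpec_inv_naturality, ← Spec.map_comp_assoc, specToLeft]
  congr 2
  ext : 1
  simpa only [CommRingCat.hom_comp, CommRingCat.hom_ofHom] using hψ

end Spec

end Literature.AlgebraicGeometry.Motives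

end
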